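import Summits.QuantumFields.BalabanUV.T4Continuum.Support.VariationalColourTaxiTower
import Summits.QuantumFields.BalabanUV.T4Continuum.Support.VariationalVectorGaugeSlice
import Summits.QuantumFields.BalabanUV.T4Continuum.Support.VariationalVectorOneStepPhys

/-!
# T⁴ programme, spine node NE2 (U1a), lane P2 — «V-GAUGE-COV», file 1: EXACT GAUGE COVARIANCE OF THE VECTOR ROAD's OBJECTS
# (bond transports, 0- and 1-forms, covariant differences, curl, divergence, Laplacian, Hessian, the road's sizes) under a unitary lattice gauge
# transformation (model level; cell `pub-balaban`)

NE2 formalisation swarm `b2b-balaban-t4-ne2-formalise-*`, leaf prover 03 GEN 7 (`prover-b2b-balaban-t4-ne2-formalise-leaf-03-g7-0`); register row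
«P2-sup» of `t4/formal/NE2/LEAVES.md`; journal INTENT «V-GAUGE-COV» CLAIMS.log l.19543 (2026-08-20 18:50Z).

THE POINT.  Every END of the road (`VariationalVectorEndMonotone.effV_tendsto_of_upper(_geom)` p226720, `VariationalColourTaxiTowerProjG.effV_tendsto_taxiTower_projG_of_class`
p229644, and the regular-class files `ProjGDivControlRegular` p230574 ∕ `DivControlCovariantFrames` p231645) is a statement about a PRESENTED tower of bond operators, and
the regular class (`‖R − 1‖ ≤ a`, lattice-Lipschitz `ℓ`) depends on the presentation, whereas [Balaban1985BackgroundPropagators] (3.35)–(3.36) is a statement about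
a gauge ORBIT («there is a gauge in which …»); the files above say so («gauge covariance NOT proved»).  This file proves the EXACT transformation laws of the road's
typed objects under a lattice gauge transformation = a UNITARY SITE FIELD `u : Tor N → (E →L[ℂ] E)` (fine lattice) together with a unitary site field `v` on the unit
lattice (the frame ends):
 * §1 the gauged data (DATA `def`s): `gaugeR u R x μ = u x ∘ R x μ ∘ (u (x+e_μ))⋆`, `gaugeS u f x = u x (f x)`, `gaugeW u W x μ = u x (W x μ)`, frames
   and line carriers in file 1b; unitarity ∕ inverses ∕ bijectivity;
 * §2 differences: `cDv (gaugeR u R) (gaugeS u f) = gaugeW u (cDv R f)`, `cdV`, `curlV`, `DirAdjv`, `divV`, `lapOp`; INVARIANCE of `dirUv`, `curlSq`, `divSq`, `nsqv`, `nsqV`,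
   `qWV`, `roughV`, `hessv` ∕ `hessV` ∕ `rhoV`;
File 1b (`VectorGaugeCovarianceCarriers`): frames `gaugeF`, line carriers `gaugeL`, the laws for `piTv` ∕ `coarseTv` ∕ `Rtrv` ∕ `taxiTv` ∕ `lineT` ∕ `compL` and the
transported averages `Qcv` ∕ `avgOp` (kernel transported) ∕ `QvL`; file 2 (`VectorGaugeCovarianceSlice`): the `ℓ²` isometry, `sliceSub` ∕ `projG` ∕ `ScV` ∕ `SfV`; file 3
(`VectorGaugeCovarianceEnd`, `E = ℂ`): `effV` conjugation, the displayed binders are gauge-invariant statements, and the GAUGE-ORBIT TRANSFER of the monotone END.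

HONEST FRAMING (T4-DAG p. 1).  Model level (c5): bond operators ∕ frames ∕ carriers are DATA and a «gauge transformation» here is a unitary site field acting on OUR
typed objects — no identification with Bałaban's `U` (no B0); [folklore] algebra, NO analytic content; the EXISTENCE of a regular gauge for small-curvature data
([Balaban1985RegularGauge] territory ∕ node NE3) is NOT claimed; data `def`s only (`gaugeR`, `gaugeS`, `gaugeW`, `mulS`), no `def … : Prop`, no
`sorry`; axioms standard.  V-END with background ∕ NE2 NOT proved; NE3 OPEN; spine PROVED 0∕9 unchanged; rung (B)+1 on a fixed finite T⁴ — NOT infinite volume, NOT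
mass gap, NOT Clay.  HONEST DEPENDENCY (cell, verbatim): continuum YM on T⁴ ⇐ BetaPertH ∧ nine spine estimates (0/9 proved); BetaPertH ⇐ (D1) ∧ (D4) ∧ CAP+tail;
G-an2-4 gates asym, D1 and NE2/3/4.
-/

noncomputable section

namespace Summit.QuantumFields.BalabanUV.T4Continuum.VectorGaugeCovariance

open Finset
open scoped BigOperators
open Literature.MathematicalPhysics.QuantumFieldTheory.Balaban1983to89.B5Prop11Plancherel (Tor fine unitVec)
open Literature.MathematicalPhysics.QuantumFieldTheory.Balaban1983to89.B5Block118 (tstep tstep_zero tstep_succ bpt bpt_add_tstep)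
open Literature.MathematicalPhysics.QuantumFieldTheory.Balaban1983to89.B5Blocks16 (blockOf blockOf_bpt)
open Literature.MathematicalPhysics.QuantumFieldTheory.Balaban1983to89.B5Composition116 (sites J JEquiv JEquiv_apply bpt_bpt_tstep)
open Summit.QuantumFields.BalabanUV.T4Continuum.VariationalColourFederbush (cDv dirUv Qcv piTv)
open Summit.QuantumFields.BalabanUV.T4Continuum.VariationalColourBochner (Dirv DirAdjv negLapv nsqv)
open Summit.QuantumFields.BalabanUV.T4Continuum.VariationalColourInterpolant (hessv)
open Summit.QuantumFields.BalabanUV.T4Continuum.VariationalColourTower (Rtrv)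
open Summit.QuantumFields.BalabanUV.T4Continuum.VariationalCovariantTower (sites_add)
open Summit.QuantumFields.BalabanUV.T4Continuum.VariationalTower (sites_unitVec)
open Summit.QuantumFields.BalabanUV.T4Continuum.VariationalTaxiTransport (below corner corner_succ)
open Summit.QuantumFields.BalabanUV.T4Continuum.VariationalTaxiCoarse (corner_zero)
open Summit.QuantumFields.BalabanUV.T4Continuum.VariationalColourTaxiTransport (legTv taxiAcc taxiTv coarseTv)
open Summit.QuantumFields.BalabanUV.T4Continuum.VectorBlockTrialForm (nsqV QvL roughV compL val_finProdFinEquiv)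
open Summit.QuantumFields.BalabanUV.T4Continuum.VariationalVectorFederbush (lineT)
open Summit.QuantumFields.BalabanUV.T4Continuum.VariationalVectorForm (cdV curlV curlSq qWV)
open Summit.QuantumFields.BalabanUV.T4Continuum.VariationalVectorWeitzenbock (divV divSq divV_apply)
open Summit.QuantumFields.BalabanUV.T4Continuum.VariationalVectorOneStep (hessV)
open Summit.QuantumFields.BalabanUV.T4Continuum.VariationalVectorOneStepPhys (rhoV)
open Summit.QuantumFields.BalabanUV.T4Continuum.VariationalVectorGaugeSlice (avgOp avgOp_apply lapOp lapOp_apply)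

variable {d : ℕ} {E : Type*} [NormedAddCommGroup E] [InnerProductSpace ℂ E] [CompleteSpace E]

/-! ## §0 Unitary site fields: the two cancellations -/

section Unitary

variable {ι : Type*} {u : ι → (E →L[ℂ] E)} (hu : ∀ x, u x ∈ unitary (E →L[ℂ] E))
include hu

/-- `(u x)⋆ (u x v) = v`. [folklore] -/
theorem star_apply_apply (x : ι) (w : E) : star (u x) (u x w) = w := by
  have h := Unitary.star_mul_self_of_mem (hu x)
  have := congrArg (fun T : E →L[ℂ] E => T w) h
  simpa using this

/-- `u x ((u x)⋆ v) = v`. [folklore] -/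
theorem apply_star_apply (x : ι) (w : E) : u x (star (u x) w) = w := by
  have h := Unitary.mul_star_self_of_mem (hu x)
  have := congrArg (fun T : E →L[ℂ] E => T w) h
  simpa using this

/-- `(u x)⋆ ∘ u x = 1` in the operator ring. [folklore] -/
theorem star_mul_self (x : ι) : star (u x) * u x = 1 := Unitary.star_mul_self_of_mem (hu x)

/-- `u x ∘ (u x)⋆ = 1` in the operator ring. [folklore] -/
theorem mul_star_self (x : ι) : u x * star (u x) = 1 := Unitary.mul_star_self_of_mem (hu x)

/-- `‖u x w‖ = ‖w‖`. [folklore] -/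
theorem norm_apply (x : ι) (w : E) : ‖u x w‖ = ‖w‖ := ContinuousLinearMap.norm_map_of_mem_unitary (hu x) w

/-- `‖(u x)⋆ w‖ = ‖w‖`. [folklore] -/
theorem norm_star_apply (x : ι) (w : E) : ‖star (u x) w‖ = ‖w‖ :=
  ContinuousLinearMap.norm_map_of_mem_unitary (Unitary.star_mem (hu x)) w

end Unitary

/-! ## §1 The gauged data -/

section Data

variable (N : Fin d → ℕ)

/-- **gauged bond transports**: `R^u(x,μ) = u(x) ∘ R(x,μ) ∘ u(x+e_μ)⋆` (the transport of the fibre at `x + e_μ` to the fibre at `x`, re-expressed in the rotated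
fibres) ([Balaban1985BackgroundPropagators] (3.3) SHAPE «gauge transformations of a lattice connection»; operators DATA). [folklore] -/
def gaugeR (u : Tor N → (E →L[ℂ] E)) (R : Tor N → Fin d → (E →L[ℂ] E)) (x : Tor N) (μ : Fin d) : E →L[ℂ] E :=
  u x * R x μ * star (u (x + unitVec N μ))

/-- **gauged 0-forms**: `f^u(x) = u(x) f(x)`. [folklore] -/
def gaugeS (u : Tor N → (E →L[ℂ] E)) (f : Tor N → E) (x : Tor N) : E := u x (f x)

/-- **gauged `E`-valued 1-forms** (fluctuation fields, adjoint-type action site by site): `W^u(x,μ) = u(x) W(x,μ)`. [folklore] -/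
def gaugeW (u : Tor N → (E →L[ℂ] E)) (W : Tor N → Fin d → E) (x : Tor N) (μ : Fin d) : E := u x (W x μ)

/-- the fibrewise rotation of 0-forms as a `ℂ`-linear map. [folklore] -/
def mulS (u : Tor N → (E →L[ℂ] E)) : (Tor N → E) →ₗ[ℂ] (Tor N → E) where
  toFun := gaugeS N u
  map_add' f g := by funext x; simp [gaugeS]
  map_smul' c f := by funext x; simp [gaugeS]

omit [CompleteSpace E] in
/-- `mulS u f = gaugeS u f`. [folklore] -/
@[simp] theorem mulS_apply (u : Tor N → (E →L[ℂ] E)) (f : Tor N → E) : mulS N u f = gaugeS N u f := rfl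

variable {N}
variable {u : Tor N → (E →L[ℂ] E)} (hu : ∀ x, u x ∈ unitary (E →L[ℂ] E))
include hu

/-- gauged unitary transports are unitary. [folklore] -/
theorem gaugeR_mem_unitary {R : Tor N → Fin d → (E →L[ℂ] E)} (hR : ∀ x μ, R x μ ∈ unitary (E →L[ℂ] E)) (x : Tor N) (μ : Fin d) :
    gaugeR N u R x μ ∈ unitary (E →L[ℂ] E) := by
  unfold gaugeR
  exact mul_mem (mul_mem (hu x) (hR x μ)) (Unitary.star_mem (hu _))

/-- gauged contractive transports are contractive. [folklore] -/
theorem norm_gaugeR_le_one {R : Tor N → Fin d → (E →L[ℂ] E)} (hR : ∀ x μ, ‖R x μ‖ ≤ 1) (x : Tor N) (μ : Fin d) : ‖gaugeR N u R x μ‖ ≤ 1 := by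
  unfold gaugeR
  have h1 : ‖u x‖ ≤ 1 := VariationalColourFederbush.norm_le_one_of_mem_unitary (hu x)
  have h2 : ‖star (u (x + unitVec N μ))‖ ≤ 1 := VariationalColourFederbush.norm_le_one_of_mem_unitary (Unitary.star_mem (hu _))
  calc _ ≤ ‖u x * R x μ‖ * ‖star (u (x + unitVec N μ))‖ := norm_mul_le _ _
    _ ≤ (‖u x‖ * ‖R x μ‖) * ‖star (u (x + unitVec N μ))‖ := mul_le_mul_of_nonneg_right (norm_mul_le _ _) (norm_nonneg _)
    _ ≤ (1 * 1) * 1 := by gcongr; exact hR x μ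
    _ = 1 := by norm_num

/-- undoing the rotation: `gaugeS u⋆ (gaugeS u f) = f`. [folklore] -/
theorem gaugeS_star_gaugeS (f : Tor N → E) : gaugeS N (fun x => star (u x)) (gaugeS N u f) = f := by
  funext x; exact star_apply_apply hu x (f x)

/-- `gaugeS u (gaugeS u⋆ f) = f`. [folklore] -/
theorem gaugeS_gaugeS_star (f : Tor N → E) : gaugeS N u (gaugeS N (fun x => star (u x)) f) = f := by
  funext x; exact apply_star_apply hu x (f x)

/-- undoing the rotation of 1-forms. [folklore] -/
theorem gaugeW_star_gaugeW (W : Tor N → Fin d → E) : gaugeW N (fun x => star (u x)) (gaugeW N u W) = W := by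
  funext x μ; exact star_apply_apply hu x (W x μ)

/-- `gaugeW u (gaugeW u⋆ W) = W`. [folklore] -/
theorem gaugeW_gaugeW_star (W : Tor N → Fin d → E) : gaugeW N u (gaugeW N (fun x => star (u x)) W) = W := by
  funext x μ; exact apply_star_apply hu x (W x μ)

/-- the rotation of 0-forms is a bijection. [folklore] -/
theorem gaugeS_bijective : Function.Bijective (gaugeS N u) :=
  ⟨fun f g h => by simpa [gaugeS_star_gaugeS hu] using congrArg (gaugeS N (fun x => star (u x))) h,
   fun g => ⟨gaugeS N (fun x => star (u x)) g, gaugeS_gaugeS_star hu g⟩⟩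

/-- the rotation of 1-forms is a bijection. [folklore] -/
theorem gaugeW_bijective : Function.Bijective (gaugeW N u) :=
  ⟨fun f g h => by simpa [gaugeW_star_gaugeW hu] using congrArg (gaugeW N (fun x => star (u x))) h,
   fun g => ⟨gaugeW N (fun x => star (u x)) g, gaugeW_gaugeW_star hu g⟩⟩

end Data

/-! ## §2 Covariant differences, curl, divergence, Laplacian, Hessian; invariance of the sizes -/

section Differences

variable {N : Fin d → ℕ} {u : Tor N → (E →L[ℂ] E)} (hu : ∀ x, u x ∈ unitary (E →L[ℂ] E))
include hu

/-- **`D_{R^u}(f^u) = (D_R f)^u`**: `cDv (gaugeR u R) (gaugeS u f) y μ = u y (cDv R f y μ)`. [folklore] -/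
theorem cDv_gauge (R : Tor N → Fin d → (E →L[ℂ] E)) (f : Tor N → E) (y : Tor N) (μ : Fin d) :
    cDv N (gaugeR N u R) (gaugeS N u f) y μ = u y (cDv N R f y μ) := by
  simp only [cDv, gaugeR, gaugeS, mul_apply_eq_comp, star_apply_apply hu, map_sub]

/-- `Dirv` (the `μ`-difference as a field) transforms the same way. [folklore] -/
theorem Dirv_gauge (R : Tor N → Fin d → (E →L[ℂ] E)) (μ : Fin d) (f : Tor N → E) :
    Dirv N (gaugeR N u R) μ (gaugeS N u f) = gaugeS N u (Dirv N R μ f) := by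
  funext y; exact cDv_gauge hu R f y μ

/-- **the 1-form difference**: `cdV (gaugeR u R) (gaugeW u W) x μ ν = u x (cdV R W x μ ν)`. [folklore] -/
theorem cdV_gauge (R : Tor N → Fin d → (E →L[ℂ] E)) (W : Tor N → Fin d → E) (x : Tor N) (μ ν : Fin d) :
    cdV N (gaugeR N u R) (gaugeW N u W) x μ ν = u x (cdV N R W x μ ν) := by
  simp only [cdV, gaugeR, gaugeW, mul_apply_eq_comp, star_apply_apply hu, map_sub]

/-- **the covariant curl**: `curlV (gaugeR u R) (gaugeW u W) x μ ν = u x (curlV R W x μ ν)`. [folklore] -/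
theorem curlV_gauge (R : Tor N → Fin d → (E →L[ℂ] E)) (W : Tor N → Fin d → E) (x : Tor N) (μ ν : Fin d) :
    curlV N (gaugeR N u R) (gaugeW N u W) x μ ν = u x (curlV N R W x μ ν) := by
  simp only [curlV, cdV_gauge hu, map_sub]

/-- **the adjoint difference**: `DirAdjv (gaugeR u R) μ (gaugeS u g) = gaugeS u (DirAdjv R μ g)`. [folklore] -/
theorem DirAdjv_gauge (R : Tor N → Fin d → (E →L[ℂ] E)) (μ : Fin d) (g : Tor N → E) :
    DirAdjv N (gaugeR N u R) μ (gaugeS N u g) = gaugeS N u (DirAdjv N R μ g) := by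
  funext x
  simp only [DirAdjv, gaugeR, gaugeS, star_mul, star_star, sub_add_cancel, mul_apply_eq_comp, star_apply_apply hu, map_sub]

variable [∀ μ, NeZero (N μ)]

omit [∀ μ, NeZero (N μ)] in
/-- **the covariant divergence**: `divV (gaugeR u R) (gaugeW u W) x = u x (divV R W x)`. [folklore] -/
theorem divV_gauge (R : Tor N → Fin d → (E →L[ℂ] E)) (W : Tor N → Fin d → E) (x : Tor N) :
    divV N (gaugeR N u R) (gaugeW N u W) x = u x (divV N R W x) := by
  rw [divV_apply, divV_apply, map_sum]
  refine sum_congr rfl fun μ _ => ?_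
  simp only [gaugeR, gaugeW, star_mul, star_star, sub_add_cancel, mul_apply_eq_comp, star_apply_apply hu, map_sub]

omit [∀ μ, NeZero (N μ)] in
/-- **the covariant Laplacian on 0-forms**: `negLapv (gaugeR u R) (gaugeS u f) = gaugeS u (negLapv R f)`. [folklore] -/
theorem negLapv_gauge (R : Tor N → Fin d → (E →L[ℂ] E)) (f : Tor N → E) :
    negLapv N (gaugeR N u R) (gaugeS N u f) = gaugeS N u (negLapv N R f) := by
  funext x
  simp only [negLapv, gaugeS, map_sum]
  refine sum_congr rfl fun μ _ => ?_
  rw [Dirv_gauge hu, DirAdjv_gauge hu]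
  rfl

omit [∀ μ, NeZero (N μ)] in
/-- the same for the bundled `lapOp`. [folklore] -/
theorem lapOp_gauge (R : Tor N → Fin d → (E →L[ℂ] E)) (f : Tor N → E) :
    lapOp N (gaugeR N u R) (gaugeS N u f) = gaugeS N u (lapOp N R f) := by
  rw [VariationalVectorGaugeSlice.lapOp_eq_negLapv, VariationalVectorGaugeSlice.lapOp_eq_negLapv, negLapv_gauge hu]

/-- **INVARIANCE of the directional Dirichlet sums**. [folklore] -/
theorem dirUv_gauge (R : Tor N → Fin d → (E →L[ℂ] E)) (f : Tor N → E) (μ : Fin d) :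
    dirUv N (gaugeR N u R) (gaugeS N u f) μ = dirUv N R f μ := by
  unfold dirUv; exact sum_congr rfl fun y _ => by rw [cDv_gauge hu, norm_apply hu]

/-- **INVARIANCE of the curl form**. [folklore] -/
theorem curlSq_gauge (R : Tor N → Fin d → (E →L[ℂ] E)) (W : Tor N → Fin d → E) :
    curlSq N (gaugeR N u R) (gaugeW N u W) = curlSq N R W := by
  unfold curlSq
  exact sum_congr rfl fun x _ => sum_congr rfl fun μ _ => sum_congr rfl fun ν _ => by rw [curlV_gauge hu, norm_apply hu]

/-- **INVARIANCE of the divergence form**. [folklore] -/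
theorem divSq_gauge (R : Tor N → Fin d → (E →L[ℂ] E)) (W : Tor N → Fin d → E) :
    divSq N (gaugeR N u R) (gaugeW N u W) = divSq N R W := by
  unfold divSq; exact sum_congr rfl fun x _ => by rw [divV_gauge hu, norm_apply hu]

/-- **INVARIANCE of the `ℓ²` size of 0-forms**. [folklore] -/
theorem nsqv_gauge (f : Tor N → E) : nsqv N (gaugeS N u f) = nsqv N f := by
  unfold nsqv; exact sum_congr rfl fun x _ => by rw [gaugeS, norm_apply hu]

/-- **INVARIANCE of the `ℓ²` size of 1-forms**. [folklore] -/
theorem nsqV_gauge (W : Tor N → Fin d → E) : nsqV N (gaugeW N u W) = nsqV N W := by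
  unfold nsqV; exact sum_congr rfl fun x _ => sum_congr rfl fun μ _ => by rw [gaugeW, norm_apply hu]

/-- **INVARIANCE of the covariant Hessian of a 0-form**. [folklore] -/
theorem hessv_gauge (R : Tor N → Fin d → (E →L[ℂ] E)) (f : Tor N → E) :
    hessv N (gaugeR N u R) (gaugeS N u f) = hessv N R f := by
  unfold hessv
  refine sum_congr rfl fun μ _ => sum_congr rfl fun ν _ => ?_
  have h : (fun z => cDv N (gaugeR N u R) (gaugeS N u f) z ν) = gaugeS N u (fun z => cDv N R f z ν) := by
    funext z; exact cDv_gauge hu R f z ν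
  rw [h, dirUv_gauge hu]

/-- **INVARIANCE of the covariant Hessian of a 1-form**. [folklore] -/
theorem hessV_gauge (R : Tor N → Fin d → (E →L[ℂ] E)) (W : Tor N → Fin d → E) :
    hessV N (gaugeR N u R) (gaugeW N u W) = hessV N R W := by
  unfold hessV
  refine sum_congr rfl fun ν _ => ?_
  have h : (fun z => gaugeW N u W z ν) = gaugeS N u (fun z => W z ν) := rfl
  rw [h, hessv_gauge hu]

end Differences

section Sizes

variable (n : ℕ) [NeZero n] (M : Fin d → ℕ) [hM : ∀ μ, NeZero (M μ)]
variable {u : Tor (fine n M) → (E →L[ℂ] E)} (hu : ∀ x, u x ∈ unitary (E →L[ℂ] E))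
include hu

/-- **INVARIANCE of the P⁺ size** `qWV`. [folklore] -/
theorem qWV_gauge (W : Tor (fine n M) → Fin d → E) : qWV n M (gaugeW (fine n M) u W) = qWV n M W := by
  unfold qWV; rw [nsqV_gauge hu]

/-- **INVARIANCE of the rough Dirichlet form**. [folklore] -/
theorem roughV_gauge (R : Tor (fine n M) → Fin d → (E →L[ℂ] E)) (W : Tor (fine n M) → Fin d → E) :
    roughV n M (gaugeR (fine n M) u R) (gaugeW (fine n M) u W) = roughV n M R W := by
  unfold roughV
  refine sum_congr rfl fun ν _ => sum_congr rfl fun μ _ => sum_congr rfl fun x _ => ?_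
  have h : gaugeR (fine n M) u R x ν (gaugeW (fine n M) u W (x + unitVec (fine n M) ν) μ) - gaugeW (fine n M) u W x μ
      = u x (R x ν (W (x + unitVec (fine n M) ν) μ) - W x μ) := by
    simp only [gaugeR, gaugeW, mul_apply_eq_comp, star_apply_apply hu, map_sub]
  rw [h, norm_apply hu]

/-- **INVARIANCE of the regularity functional** `rhoV`. [folklore] -/
theorem rhoV_gauge (R : Tor (fine n M) → Fin d → (E →L[ℂ] E)) (W : Tor (fine n M) → Fin d → E) :
    rhoV n M (gaugeR (fine n M) u R) (gaugeW (fine n M) u W) = rhoV n M R W := by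
  unfold rhoV; rw [hessV_gauge hu]

end Sizes

end Summit.QuantumFields.BalabanUV.T4Continuum.VectorGaugeCovariance

end
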